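import Literature.Analysis.Complex.WeylLemmaDbar
import HarnessLib

/-!
# Weyl's lemma for `∂/∂z̄`, measure form: a `∂̄`-closed complex measure is a holomorphic density

The form consumed by weak-* limits of `L¹`-bounded families (which are complex Radon MEASURES,
not functions): write the measure in polar form `h dν` with `ν` a positive measure and `h`
`ν`-integrable.

**Theorem (`weyl_dbar_ball_measure`).** If `∫ h · ∂̄φ dν = 0` for every smooth `φ : ℂ → ℂ` with
compact support in `B̄(z₀, 3R)`, then there is `g` holomorphic on `B(z₀, 3R/2)` such that
`∫ φ h dν = ∫ φ g dA` for every smooth `φ` compactly supported in `B(z₀, R)`: on `B(z₀, R)` the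
measure `h dν` IS the holomorphic density `g` (Hörmander, *ALPDO I*, Thm. 4.4.1 — hypoellipticity
of `∂/∂z̄` for distributions; H. Weyl 1940). [folklore]

Same proof as the `L¹` form (`Literature/Analysis/Complex/WeylLemmaDbar.lean`): with a cut-off `χ`
(`= 1` on `B̄(z₀, 2R)`, supported in `B̄(z₀, 3R)`) and the Cauchy transform `ψ = K ⋆ φ` of a test
function `φ` (`∂̄ψ = φ`, Hörmander Thm. 1.2.2, `dbarAlong_one_cauchyTransform`), the admissible
test function `χψ` gives `∫ φ h dν = -∫ ψ ∂̄χ h dν = ∫ φ(w) g(w) dA(w)`,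
`g(w) = -∫ (π(z - w))⁻¹ ∂̄χ(z) h(z) dν(z)` (Fubini for `ν ⊗ dA`; the kernel is evaluated only at
`|z - w| ≥ R`), and `g` is holomorphic on `B(z₀, 3R/2)` by differentiation under the integral sign
(`differentiableOn_integral_mul_cauchyKernel_measure`, the version of the previous file's lemma
for an arbitrary measure). Here no fundamental lemma is needed: the conclusion is the identity
of functionals itself.
-/

noncomputable section

open MeasureTheory Set Filter Function Complex Metric
open scoped Real Topology ContDiff

namespace Literature.Analysis.Complex

/-- **Holomorphy of the Cauchy transform of a measure off its support.** If `F` is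
`μ`-integrable and vanishes on `B(c, ρ₁)`, then for `ρ₂ < ρ₁` the function
`w ↦ ∫ F(z) (π (z - w))⁻¹ dμ(z)` is holomorphic on `B(c, ρ₂)` (differentiation under the integral
sign against `μ`; Hörmander 1973, Thm. 1.2.2, first part, for measures). [folklore] -/
theorem differentiableOn_integral_mul_cauchyKernel_measure {μ : Measure ℂ} {F : ℂ → ℂ}
    (hF : Integrable F μ) {c : ℂ} {ρ₁ ρ₂ : ℝ} (hρ : ρ₂ < ρ₁) (hzero : ∀ z ∈ ball c ρ₁, F z = 0) :
    DifferentiableOn ℂ (fun w => ∫ z, F z * (↑π * (z - w))⁻¹ ∂μ) (ball c ρ₂) := by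
  intro w₀ hw₀
  set d : ℝ := ρ₁ - ρ₂ with hd
  have hd0 : 0 < d := by rw [hd]; linarith
  have hfar : ∀ z, F z ≠ 0 → ∀ w ∈ ball c ρ₂, d ≤ ‖z - w‖ := by
    intro z hz w hw
    have hz' : ρ₁ ≤ dist z c := by
      by_contra h; exact hz (hzero z (mem_ball.2 (lt_of_not_ge h)))
    rw [mem_ball] at hw
    have := dist_triangle z w c
    simp only [dist_eq_norm] at this hw hz'
    linarith
  set G : ℂ → ℂ → ℂ := fun w z => F z * (↑π * (z - w))⁻¹ with hG
  set G' : ℂ → ℂ → ℂ := fun w z => F z * ((↑π)⁻¹ * ((z - w) ^ 2)⁻¹) with hG'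
  have hmeasK : ∀ w, AEStronglyMeasurable (G w) μ := fun w =>
    hF.aestronglyMeasurable.mul
      ((continuous_const.mul (continuous_id.sub continuous_const)).measurable.inv.aestronglyMeasurable)
  have hint : ∀ w ∈ ball c ρ₂, Integrable (G w) μ := by
    intro w hw
    refine Integrable.mono' (hF.norm.mul_const (π⁻¹ * d⁻¹)) (hmeasK w) (Eventually.of_forall ?_)
    intro z
    simp only [hG, norm_mul]
    by_cases hz : F z = 0
    · simp [hz]
    · have hzw := hfar z hz w hw
      have hzw0 : 0 < ‖z - w‖ := hd0.trans_le hzw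
      refine mul_le_mul_of_nonneg_left ?_ (norm_nonneg _)
      rw [norm_inv, norm_mul, Complex.norm_real, Real.norm_eq_abs, abs_of_pos Real.pi_pos,
        mul_inv]
      exact mul_le_mul_of_nonneg_left (inv_anti₀ hd0 hzw) (by positivity)
  have hmeas' : AEStronglyMeasurable (G' w₀) μ := by
    refine hF.aestronglyMeasurable.mul (Measurable.aestronglyMeasurable ?_)
    exact measurable_const.mul ((measurable_id.sub measurable_const).pow_const 2).inv
  have hbound : ∀ᵐ z ∂μ, ∀ w ∈ ball c ρ₂, ‖G' w z‖ ≤ ‖F z‖ * (π⁻¹ * (d ^ 2)⁻¹) := by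
    refine Eventually.of_forall fun z w hw => ?_
    simp only [hG', norm_mul, norm_inv, norm_pow, Complex.norm_real, Real.norm_eq_abs,
      abs_of_pos Real.pi_pos]
    by_cases hz : F z = 0
    · simp [hz]
    · have hzw := hfar z hz w hw
      refine mul_le_mul_of_nonneg_left ?_ (norm_nonneg _)
      refine mul_le_mul_of_nonneg_left ?_ (by positivity)
      exact inv_anti₀ (pow_pos hd0 2) (pow_le_pow_left₀ hd0.le hzw 2)
  have hdiff : ∀ᵐ z ∂μ, ∀ w ∈ ball c ρ₂, HasDerivAt (G · z) (G' w z) w := by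
    refine Eventually.of_forall fun z w hw => ?_
    by_cases hz : F z = 0
    · simp only [hG, hG', hz, zero_mul]; exact hasDerivAt_const w 0
    · have hzw : z - w ≠ 0 := by
        have := hfar z hz w hw; intro h0; rw [h0, norm_zero] at this; linarith
      have hπ : (π : ℂ) ≠ 0 := ofReal_ne_zero.2 Real.pi_pos.ne'
      have h1 : HasDerivAt (fun w : ℂ => ↑π * (z - w)) (↑π * (0 - 1)) w :=
        ((hasDerivAt_const w z).sub (hasDerivAt_id w)).const_mul _
      have h2 : HasDerivAt (G · z) (F z * (-(↑π * (0 - 1)) / (↑π * (z - w)) ^ 2)) w :=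
        (h1.inv (mul_ne_zero hπ hzw)).const_mul (F z)
      refine h2.congr_deriv ?_
      simp only [hG']
      field_simp
      ring
  have key := hasDerivAt_integral_of_dominated_loc_of_deriv_le (isOpen_ball.mem_nhds hw₀)
    (Eventually.of_forall hmeasK) (hint w₀ hw₀) hmeas' hbound (hF.norm.mul_const _) hdiff
  exact key.2.differentiableAt.differentiableWithinAt

/-- **Weyl's lemma for `∂/∂z̄`, measure form (local).** Let `ν` be an s-finite measure on `ℂ`, `h`
`ν`-integrable with `∫ h · ∂̄φ dν = 0` for every smooth `φ : ℂ → ℂ` compactly supported in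
`B̄(z₀, 3R)`. Then there is `g` holomorphic on `B(z₀, 3R/2)` with `∫ φ h dν = ∫ φ g dA` for
every smooth `φ` compactly supported in `B(z₀, R)`: locally the `∂̄`-closed complex measure
`h dν` is the holomorphic density `g` (Hörmander, *ALPDO I*, Thm. 4.4.1; H. Weyl 1940). [folklore] -/
theorem weyl_dbar_ball_measure {ν : Measure ℂ} [SFinite ν] {h : ℂ → ℂ} (hh : Integrable h ν)
    {z₀ : ℂ} {R : ℝ} (hR : 0 < R)
    (hyp : ∀ φ : ℂ → ℂ, ContDiff ℝ ∞ φ → HasCompactSupport φ →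
      tsupport φ ⊆ closedBall z₀ (3 * R) → ∫ z, h z * dbarAlong 1 φ z ∂ν = 0) :
    ∃ g : ℂ → ℂ, DifferentiableOn ℂ g (ball z₀ (3 * R / 2)) ∧
      ∀ φ : ℂ → ℂ, ContDiff ℝ ∞ φ → HasCompactSupport φ → tsupport φ ⊆ ball z₀ R →
        ∫ z, φ z * h z ∂ν = ∫ z, φ z * g z := by
  -- the cut-off `χ`
  let χ : ContDiffBump z₀ := ⟨2 * R, 3 * R, by linarith, by linarith⟩
  set χc : ℂ → ℂ := fun z => ((χ z : ℝ) : ℂ) with hχc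
  have hχc_smooth : ContDiff ℝ ∞ χc := contDiff_ofReal_comp χ.contDiff
  have hχc_diff : ∀ z, DifferentiableAt ℝ χc z := fun z =>
    (hχc_smooth.differentiable (by simp)).differentiableAt
  have hχc_one : ∀ z ∈ closedBall z₀ (2 * R), χc z = 1 := fun z hz => by
    simp [hχc, χ.one_of_mem_closedBall (show z ∈ closedBall z₀ χ.rIn from hz)]
  have hχc_supp : tsupport χc ⊆ closedBall z₀ (3 * R) := by
    refine (tsupport_ofReal_comp_subset χ).trans ?_
    rw [χ.tsupport_eq]
  have hχc_cpt : HasCompactSupport χc := χ.hasCompactSupport.comp_left ofReal_zero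
  set dχ : ℂ → ℂ := dbarAlong 1 χc with hdχ
  have hdχ_cont : Continuous dχ := by
    have hc : Continuous (fderiv ℝ χc) := hχc_smooth.continuous_fderiv (by simp)
    have : dχ = fun z => (2 : ℂ)⁻¹ • (fderiv ℝ χc z 1 + I • fderiv ℝ χc z I) := by
      ext z; rw [hdχ, dbarAlong_one]
    rw [this]
    exact ((hc.clm_apply continuous_const).add
      ((hc.clm_apply continuous_const).const_smul I)).const_smul ((2 : ℂ)⁻¹)
  have hdχ_zero_in : ∀ z ∈ ball z₀ (2 * R), dχ z = 0 := fun z hz =>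
    dbarAlong_eq_zero_of_eventuallyEq_const (c := 1) (by
      filter_upwards [isOpen_ball.mem_nhds hz] with w hw
      exact hχc_one w (ball_subset_closedBall hw))
  have hdχ_zero_out : ∀ z, z ∉ closedBall z₀ (3 * R) → dχ z = 0 := fun z hz =>
    dbarAlong_eq_zero_of_notMem_tsupport fun h' => hz (hχc_supp h')
  have hdχ_cpt : HasCompactSupport dχ := HasCompactSupport.intro (isCompact_closedBall _ _) hdχ_zero_out
  obtain ⟨B, hB⟩ := hdχ_cont.bounded_above_of_compact_support hdχ_cpt
  -- `F = h ∂̄χ` and the holomorphic density `g`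
  set F : ℂ → ℂ := fun z => h z * dχ z with hF
  have hF_int : Integrable F ν := hh.mul_bdd hdχ_cont.aestronglyMeasurable (Eventually.of_forall hB)
  have hF_zero_in : ∀ z ∈ ball z₀ (2 * R), F z = 0 := fun z hz => by simp [hF, hdχ_zero_in z hz]
  have hF_zero_out : ∀ z, z ∉ closedBall z₀ (3 * R) → F z = 0 := fun z hz => by
    simp [hF, hdχ_zero_out z hz]
  set g : ℂ → ℂ := fun w => -∫ z, F z * (↑π * (z - w))⁻¹ ∂ν with hg
  have hg_hol : DifferentiableOn ℂ g (ball z₀ (3 * R / 2)) :=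
    (differentiableOn_integral_mul_cauchyKernel_measure hF_int
      (by linarith : 3 * R / 2 < 2 * R) hF_zero_in).neg
  refine ⟨g, hg_hol, fun φ hφ hφc hφs => ?_⟩
  have hφ1 : ContDiff ℝ 1 φ := hφ.of_le (by exact_mod_cast le_top)
  have hφ_cont : Continuous φ := hφ.continuous
  have hφ_int : Integrable φ := hφ_cont.integrable_of_hasCompactSupport hφc
  obtain ⟨Bφ, hBφ⟩ := hφ_cont.bounded_above_of_compact_support hφc
  -- the Cauchy transform `ψ` of `φ` and the admissible test function `Φ = χ ψ`
  set ψ : ℂ → ℂ := fun z : ℂ => ∫ t : ℂ, (↑π * t)⁻¹ • φ (z - t) with hψ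
  have hψ_smooth : ContDiff ℝ ∞ ψ := contDiff_cauchyTransform hφ hφc
  have hψ_diff : ∀ z, DifferentiableAt ℝ ψ z := fun z =>
    (hψ_smooth.differentiable (by simp)).differentiableAt
  have hψ_dbar : ∀ z, dbarAlong 1 ψ z = φ z := fun z => dbarAlong_one_cauchyTransform hφ1 hφc z
  set Φ : ℂ → ℂ := fun z => χc z * ψ z with hΦ
  have hΦ_smooth : ContDiff ℝ ∞ Φ := hχc_smooth.mul hψ_smooth
  have hΦ_cpt : HasCompactSupport Φ := hχc_cpt.mul_right
  have hΦ_supp : tsupport Φ ⊆ closedBall z₀ (3 * R) :=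
    (tsupport_mul_subset_left (f := χc) (g := ψ)).trans hχc_supp
  have hΦ_dbar : ∀ z, dbarAlong 1 Φ z = dχ z * ψ z + χc z * φ z := fun z => by
    rw [show dbarAlong 1 Φ z = dbarAlong 1 (fun w => χc w * ψ w) z from rfl,
      dbarAlong_one_mul (hχc_diff z) (hψ_diff z), hψ_dbar]
  have hχφ : ∀ z, χc z * φ z = φ z := fun z => by
    by_cases hz : z ∈ tsupport φ
    · rw [hχc_one z (closedBall_subset_closedBall (by linarith)
        (ball_subset_closedBall (hφs hz))), one_mul]
    · rw [image_eq_zero_of_notMem_tsupport hz, mul_zero]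
  -- the hypothesis on `Φ`: `∫ F ψ dν + ∫ φ h dν = 0`
  have h0 := hyp Φ hΦ_smooth hΦ_cpt hΦ_supp
  have hptw : ∀ z, h z * dbarAlong 1 Φ z = F z * ψ z + φ z * h z := by
    intro z; rw [hΦ_dbar, hχφ, hF]; ring
  simp_rw [hptw] at h0
  obtain ⟨Bψ, hBψ⟩ : ∃ C, ∀ z ∈ closedBall z₀ (3 * R), ‖ψ z‖ ≤ C :=
    (isCompact_closedBall z₀ (3 * R)).exists_bound_of_continuousOn hψ_smooth.continuous.continuousOn
  have hFψ_int : Integrable (fun z => F z * ψ z) ν := by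
    refine Integrable.mono' (hF_int.norm.mul_const Bψ) (hF_int.aestronglyMeasurable.mul
      hψ_smooth.continuous.aestronglyMeasurable) (Eventually.of_forall fun z => ?_)
    simp only [norm_mul]
    by_cases hz : z ∈ closedBall z₀ (3 * R)
    · exact mul_le_mul_of_nonneg_left (hBψ z hz) (norm_nonneg _)
    · simp [hF_zero_out z hz]
  have hφh_int : Integrable (fun z => φ z * h z) ν :=
    hh.bdd_mul hφ_cont.aestronglyMeasurable (Eventually.of_forall hBφ)
  rw [integral_add hFψ_int hφh_int] at h0
  -- Fubini for `ν ⊗ dA`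
  have hψw : ∀ z, ψ z = ∫ w, (↑π * (z - w))⁻¹ * φ w := fun z => by
    rw [hψ]
    simp only [smul_eq_mul]
    rw [← integral_sub_left_eq_self (fun w => (↑π * (z - w))⁻¹ * φ w) volume z]
    congr 1
    ext t
    simp
  set H : ℂ → ℂ → ℂ := fun z w => F z * (↑π * (z - w))⁻¹ * φ w with hH
  have hH_meas : AEStronglyMeasurable (uncurry H) (ν.prod volume) := by
    refine ((hF_int.aestronglyMeasurable.comp_fst).mul
      (Measurable.aestronglyMeasurable ?_)).mul (hφ_cont.aestronglyMeasurable.comp_snd)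
    exact (measurable_const.mul (measurable_fst.sub measurable_snd)).inv
  have hH_int : Integrable (uncurry H) (ν.prod volume) := by
    refine Integrable.mono' (hF_int.norm.mul_prod (hφ_int.norm.const_mul (π⁻¹ * R⁻¹)))
      hH_meas (Eventually.of_forall ?_)
    rintro ⟨z, w⟩
    simp only [uncurry, hH, norm_mul]
    by_cases hz : F z = 0
    · simp [hz]
    by_cases hw : φ w = 0
    · simp [hw]
    have hzfar : 2 * R ≤ dist z z₀ := by
      by_contra h'
      exact hz (hF_zero_in z (mem_ball.2 (lt_of_not_ge h')))
    have hwin : dist w z₀ < R := mem_ball.1 (hφs (subset_tsupport _ (mem_support.2 hw)))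
    have hzw : R ≤ ‖z - w‖ := by
      have := dist_triangle z w z₀
      simp only [dist_eq_norm] at this hzfar hwin
      linarith
    have hker : ‖(↑π * (z - w))⁻¹‖ ≤ π⁻¹ * R⁻¹ := by
      rw [norm_inv, norm_mul, Complex.norm_real, Real.norm_eq_abs, abs_of_pos Real.pi_pos,
        mul_inv]
      exact mul_le_mul_of_nonneg_left (inv_anti₀ hR hzw) (by positivity)
    calc ‖F z‖ * ‖(↑π * (z - w))⁻¹‖ * ‖φ w‖ ≤ ‖F z‖ * (π⁻¹ * R⁻¹) * ‖φ w‖ := by gcongr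
      _ = ‖F z‖ * (π⁻¹ * R⁻¹ * ‖φ w‖) := by ring
  have hfub : ∫ z, F z * ψ z ∂ν = ∫ w, φ w * ∫ z, F z * (↑π * (z - w))⁻¹ ∂ν := by
    calc ∫ z, F z * ψ z ∂ν = ∫ z, ∫ w, H z w ∂volume ∂ν := by
          congr 1; ext z
          rw [hψw, ← integral_const_mul]
          congr 1; ext w
          simp only [hH]; ring
      _ = ∫ w, ∫ z, H z w ∂ν ∂volume := integral_integral_swap hH_int
      _ = ∫ w, φ w * ∫ z, F z * (↑π * (z - w))⁻¹ ∂ν := by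
          congr 1; ext w
          rw [← integral_const_mul]
          congr 1; ext z
          simp only [hH]; ring
  have hgw : ∫ z, φ z * g z = -∫ w, φ w * ∫ z, F z * (↑π * (z - w))⁻¹ ∂ν := by
    rw [← integral_neg]
    congr 1; ext w
    simp only [hg]; ring
  rw [hfub] at h0
  rw [hgw]
  linear_combination h0

end Literature.Analysis.Complex

end
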